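import Summits.Ventures.PercRepro.C026ProdCFCone
import Summits.Ventures.PercRepro.C026ProdCFGluingDict

/-!
# THEOREM PROD-CF, the graph half (2): (CF) composes over a 3-terminal gluing (p5, gen 16)

mine-3's product theorem for (CF) (`proofs/MINE3-PRODUCT.md` §2b, Corollary 3): C-026 at `p = ½`
is component-wise. In the tree's vocabulary: for a marked multigraph `G` that is p6's 3-terminal
gluing `IsGluing a b c side` of its two parts `G.part side true`, `G.part side false` at the marks,

  **`slackCF_gluing_nonneg`**: `0 ≤ Δ_CF(G₁)` and `0 ≤ Δ_CF(G₀)` imply `0 ≤ Δ_CF(G)`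

(`slackCF = Δ_CF = #ac|b + #bc|a − #N²`, `C026DCSub` / `C026TwoTimesCF`), with NO hypothesis on the
parts beyond (CF) itself — no 3-attachment, no Theorem C′ (a part attached to ≤ 2 marks satisfies
(CF) trivially and is absorbed by this theorem). The `k`-component statement of mine-3 is this
theorem iterated over the components of `G − {a, b, c}`.

The six counts of a marked multigraph (`C026ProdCFEvents`) are packaged as integers
`apartCount = T`, `apartIsoBCount = P`, `apartIsoACount = Q`, `apartBotCount = Z`,
`isoBCount = Mₐ`, `isoACount = M_b`:

* `slackCF_eq_counts`: `Δ_CF = Mₐ + M_b + P + Q − 3T − Z` (the three identities of `C026ProdCFEvents`);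
* `counts_facts`: the `K_CF` conditions of the six counts of ONE graph in the product coordinates
  (all but the last, which is (CF) itself);
* `apartCount_gluing`, …, `isoACount_gluing`: each of the six counts MULTIPLIES over a gluing
  (`card_filter_cut` + the gluing dictionary of `C026ProdCFGluingDict`);
* `slackCF_gluing_nonneg`: the assembly through the two-generator inequality
  `ProdCF.prodCF_two'` of `C026ProdCFCone`; `card_nTwo_le_of_gluing` is the conclusion in the
  form `#N² ≤ #ac|b + #bc|a`.
-/

namespace PercRepro

open Finset

namespace MultiGraph

section ProdCFGluing

variable {V E : Type*} (G : MultiGraph V E)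

open Classical in
/-- `T = #Apart` as an integer. -/
noncomputable def apartCount [Fintype E] (a b c : V) : ℤ :=
  (univ.filter fun ω : Config E => G.Apart ω a b c).card

open Classical in
/-- `P = #{Apart ∧ b iso}` as an integer. -/
noncomputable def apartIsoBCount [Fintype E] (a b c : V) : ℤ :=
  (univ.filter fun ω : Config E => G.Apart ω a b c ∧ G.IsoMark ω b a c).card

open Classical in
/-- `Q = #{Apart ∧ a iso}` as an integer. -/
noncomputable def apartIsoACount [Fintype E] (a b c : V) : ℤ :=
  (univ.filter fun ω : Config E => G.Apart ω a b c ∧ G.IsoMark ω a b c).card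

open Classical in
/-- `Z = #{Apart ∧ IsBot}` as an integer. -/
noncomputable def apartBotCount [Fintype E] (a b c : V) : ℤ :=
  (univ.filter fun ω : Config E => G.Apart ω a b c ∧ G.IsBot ω a b c).card

open Classical in
/-- `Mₐ = #{b iso}` as an integer. -/
noncomputable def isoBCount [Fintype E] (a b c : V) : ℤ :=
  (univ.filter fun ω : Config E => G.IsoMark ω b a c).card

open Classical in
/-- `M_b = #{a iso}` as an integer. -/
noncomputable def isoACount [Fintype E] (a b c : V) : ℤ :=
  (univ.filter fun ω : Config E => G.IsoMark ω a b c).card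

variable {G}

open Classical in
/-- **`Δ_CF` in the six counts**: `Δ_CF = Mₐ + M_b + P + Q − 3T − Z` (from `#N² + P + Q = T + Z`,
`#ac|b + T = Mₐ`, `#bc|a + T = M_b`). -/
theorem slackCF_eq_counts [Fintype E] (a b c : V) :
    G.slackCF a b c = G.isoBCount a b c + G.isoACount a b c + G.apartIsoBCount a b c +
      G.apartIsoACount a b c - 3 * G.apartCount a b c - G.apartBotCount a b c := by
  rw [slackCF_eq]
  have h1 := card_nTwo_add (G := G) a b c
  have h2 := card_cell_ac_add (G := G) a b c
  have h3 := card_cell_bc_add (G := G) a b c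
  unfold isoBCount isoACount apartIsoBCount apartIsoACount apartCount apartBotCount
  zify at h1 h2 h3
  linarith

open Classical in
/-- **The `K_CF` conditions of the six counts of one graph** (in the product coordinates of
`ProdCF.prodCF_two'`, all but (CF)): `0 ≤ Z ≤ P, Q`, `P + Q ≤ T + Z`, `T ≤ Mₐ, M_b`,
`P + T ≤ Mₐ + Z`, `Q + T ≤ M_b + Z`. -/
theorem counts_facts [Fintype E] (a b c : V) :
    0 ≤ G.apartBotCount a b c ∧ G.apartBotCount a b c ≤ G.apartIsoBCount a b c ∧
      G.apartBotCount a b c ≤ G.apartIsoACount a b c ∧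
      G.apartIsoBCount a b c + G.apartIsoACount a b c ≤ G.apartCount a b c + G.apartBotCount a b c ∧
      G.apartCount a b c ≤ G.isoBCount a b c ∧ G.apartCount a b c ≤ G.isoACount a b c ∧
      G.apartIsoBCount a b c + G.apartCount a b c ≤ G.isoBCount a b c + G.apartBotCount a b c ∧
      G.apartIsoACount a b c + G.apartCount a b c ≤ G.isoACount a b c + G.apartBotCount a b c := by
  have h1 := card_nTwo_add (G := G) a b c
  have h2 := card_cell_ac_add (G := G) a b c
  have h3 := card_cell_bc_add (G := G) a b c
  have h4 := card_apart_isBot_le_isoB (G := G) a b c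
  have h5 := card_apart_isBot_le_isoA (G := G) a b c
  have h6 := card_apart_isoB_le (G := G) a b c
  have h7 := card_apart_isoA_le (G := G) a b c
  unfold isoBCount isoACount apartIsoBCount apartIsoACount apartCount apartBotCount
  zify at h1 h2 h3 h4 h5 h6 h7
  refine ⟨by positivity, h4, h5, by linarith, by linarith, by linarith, by linarith, by linarith⟩

/-! ### The six counts multiply over a gluing -/

open Classical in
/-- `T` multiplies: `Apart` is part-wise. -/
theorem apartCount_gluing [Fintype E] {a b c : V} {side : E → Bool} (hg : G.IsGluing a b c side) :
    G.apartCount a b c =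
      (G.part side true).apartCount a b c * (G.part side false).apartCount a b c := by
  unfold apartCount
  rw [← Nat.cast_mul]
  congr 1
  rw [Finset.filter_congr fun ω _ => apart_gluing_iff hg ω]
  convert card_filter_cut side (fun ω => (G.part side true).Apart ω a b c)
    (fun ω => (G.part side false).Apart ω a b c) using 4
  repeat first | rfl | exact Subsingleton.elim _ _ | congr 1

/-- The two marks other than `b` are `a` and `c`. -/
theorem cover_b {a b c : V} : ∀ w, (w = a ∨ w = b ∨ w = c) → w ≠ b → w = a ∨ w = c := by
  rintro w (rfl | rfl | rfl) hw
  · exact Or.inl rfl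
  · exact absurd rfl hw
  · exact Or.inr rfl

/-- The two marks other than `a` are `b` and `c`. -/
theorem cover_a {a b c : V} : ∀ w, (w = a ∨ w = b ∨ w = c) → w ≠ a → w = b ∨ w = c := by
  rintro w (rfl | rfl | rfl) hw
  · exact absurd rfl hw
  · exact Or.inl rfl
  · exact Or.inr rfl

open Classical in
/-- `P` multiplies: `Apart ∧ b iso` is part-wise. -/
theorem apartIsoBCount_gluing [Fintype E] {a b c : V} {side : E → Bool}
    (hg : G.IsGluing a b c side) :
    G.apartIsoBCount a b c =
      (G.part side true).apartIsoBCount a b c * (G.part side false).apartIsoBCount a b c := by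
  unfold apartIsoBCount
  rw [← Nat.cast_mul]
  congr 1
  rw [Finset.filter_congr fun ω _ => (and_congr (apart_gluing_iff hg ω)
    (isoMark_gluing_iff hg ω cover_b)).trans and_and_and_comm]
  convert card_filter_cut side
    (fun ω => (G.part side true).Apart ω a b c ∧ (G.part side true).IsoMark ω b a c)
    (fun ω => (G.part side false).Apart ω a b c ∧ (G.part side false).IsoMark ω b a c) using 4
  repeat first | rfl | exact Subsingleton.elim _ _ | congr 1

open Classical in
/-- `Q` multiplies: `Apart ∧ a iso` is part-wise. -/
theorem apartIsoACount_gluing [Fintype E] {a b c : V} {side : E → Bool}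
    (hg : G.IsGluing a b c side) :
    G.apartIsoACount a b c =
      (G.part side true).apartIsoACount a b c * (G.part side false).apartIsoACount a b c := by
  unfold apartIsoACount
  rw [← Nat.cast_mul]
  congr 1
  rw [Finset.filter_congr fun ω _ => (and_congr (apart_gluing_iff hg ω)
    (isoMark_gluing_iff hg ω cover_a)).trans and_and_and_comm]
  convert card_filter_cut side
    (fun ω => (G.part side true).Apart ω a b c ∧ (G.part side true).IsoMark ω a b c)
    (fun ω => (G.part side false).Apart ω a b c ∧ (G.part side false).IsoMark ω a b c) using 4
  repeat first | rfl | exact Subsingleton.elim _ _ | congr 1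

open Classical in
/-- `Z` multiplies: `Apart ∧ IsBot` is part-wise (p6's `isBot_gluing_iff`). -/
theorem apartBotCount_gluing [Fintype E] {a b c : V} {side : E → Bool}
    (hg : G.IsGluing a b c side) :
    G.apartBotCount a b c =
      (G.part side true).apartBotCount a b c * (G.part side false).apartBotCount a b c := by
  unfold apartBotCount
  rw [← Nat.cast_mul]
  congr 1
  rw [Finset.filter_congr fun ω _ => (and_congr (apart_gluing_iff hg ω)
    (isBot_gluing_iff hg ω)).trans and_and_and_comm]
  convert card_filter_cut side
    (fun ω => (G.part side true).Apart ω a b c ∧ (G.part side true).IsBot ω a b c)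
    (fun ω => (G.part side false).Apart ω a b c ∧ (G.part side false).IsBot ω a b c) using 4
  repeat first | rfl | exact Subsingleton.elim _ _ | congr 1

open Classical in
/-- `Mₐ` multiplies: `b iso` is part-wise. -/
theorem isoBCount_gluing [Fintype E] {a b c : V} {side : E → Bool} (hg : G.IsGluing a b c side) :
    G.isoBCount a b c = (G.part side true).isoBCount a b c * (G.part side false).isoBCount a b c := by
  unfold isoBCount
  rw [← Nat.cast_mul]
  congr 1
  rw [Finset.filter_congr fun ω _ => isoMark_gluing_iff hg ω cover_b]
  convert card_filter_cut side (fun ω => (G.part side true).IsoMark ω b a c)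
    (fun ω => (G.part side false).IsoMark ω b a c) using 4
  repeat first | rfl | exact Subsingleton.elim _ _ | congr 1

open Classical in
/-- `M_b` multiplies: `a iso` is part-wise. -/
theorem isoACount_gluing [Fintype E] {a b c : V} {side : E → Bool} (hg : G.IsGluing a b c side) :
    G.isoACount a b c = (G.part side true).isoACount a b c * (G.part side false).isoACount a b c := by
  unfold isoACount
  rw [← Nat.cast_mul]
  congr 1
  rw [Finset.filter_congr fun ω _ => isoMark_gluing_iff hg ω cover_a]
  convert card_filter_cut side (fun ω => (G.part side true).IsoMark ω a b c)
    (fun ω => (G.part side false).IsoMark ω a b c) using 4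
  repeat first | rfl | exact Subsingleton.elim _ _ | congr 1

/-! ### THEOREM PROD-CF on a gluing -/

open Classical in
/-- **THEOREM PROD-CF, graph form** (mine-3, `MINE3-PRODUCT.md` §2b, Corollary 3): **(CF) composes
over every 3-terminal gluing at the marks** — if `G` is the gluing `IsGluing a b c side` of its two
parts and both parts satisfy `0 ≤ Δ_CF`, then so does `G`. The six counts of `G` are the products
of those of the parts, the parts' counts lie in `K_CF` (the last condition being (CF) on the part),
and `ProdCF.prodCF_two'` is the inequality. No hypothesis on the parts beyond (CF). -/
theorem slackCF_gluing_nonneg [Fintype E] {a b c : V} {side : E → Bool}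
    (hg : G.IsGluing a b c side) (h₁ : 0 ≤ (G.part side true).slackCF a b c)
    (h₀ : 0 ≤ (G.part side false).slackCF a b c) : 0 ≤ G.slackCF a b c := by
  rw [slackCF_eq_counts] at h₁ h₀ ⊢
  rw [apartCount_gluing hg, apartIsoBCount_gluing hg, apartIsoACount_gluing hg,
    apartBotCount_gluing hg, isoBCount_gluing hg, isoACount_gluing hg]
  obtain ⟨f₁, f₂, f₃, f₄, f₅, f₆, f₇, f₈⟩ := counts_facts (G := G.part side true) a b c
  obtain ⟨g₁, g₂, g₃, g₄, g₅, g₆, g₇, g₈⟩ := counts_facts (G := G.part side false) a b c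
  have key := ProdCF.prodCF_two' f₁ f₂ f₃ f₄ f₅ f₆ f₇ f₈ (by linarith) g₁ g₂ g₃ g₄ g₅ g₆ g₇ g₈
    (by linarith)
  linarith

open Classical in
/-- **THEOREM PROD-CF in the (CF) form**: on a gluing whose two parts satisfy `0 ≤ Δ_CF`,
`#N² ≤ #ac|b + #bc|a`. -/
theorem card_nTwo_le_of_gluing [Fintype E] {a b c : V} {side : E → Bool}
    (hg : G.IsGluing a b c side) (h₁ : 0 ≤ (G.part side true).slackCF a b c)
    (h₀ : 0 ≤ (G.part side false).slackCF a b c) :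
    (univ.filter fun ω : Config E => G.NTwo ω a b c).card ≤
      (univ.filter fun ω : Config E => G.Conn ω c a ∧ ¬ G.Conn ω c b).card +
        (univ.filter fun ω : Config E => G.Conn ω c b ∧ ¬ G.Conn ω c a).card := by
  have h := slackCF_gluing_nonneg hg h₁ h₀
  rw [slackCF_eq] at h
  zify
  linarith

end ProdCFGluing

end MultiGraph

end PercRepro
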